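/-
Soloist `solo-ValiantsHypothesis-informed`, session 18 — the double count behind the spread bound.
-/
import Mathlib

/-!
# The spread count: aligned incidences under one-edge-per-direction

This is the finite-combinatorial core (step 1) of the SPREAD BOUND of the soloist note
`paper/quadspan.md` §7.11 (Theorem 7.54): for a one-edge-per-direction label pattern of a
constant-normal rank-3 family over `ℂ[[z]]`, at a fixed depth the classes of the digit trie met by
one column are ALIGNED (they lie in one fibre of the column's direction), and at most `X c` columns
of any one direction meet the class `c` (property (U), `X c` = number of rows of the class).  The
only combinatorial consequence used before complex Szemerédi–Trotter enters is the following double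
count, proved here for arbitrary finite data:

* classes `N`, columns `J` with directions `τ : J → D`, incidences `H ⊆ N × J`,
  fibres `Q d c ⊆ N`, masses `X : N → ℕ`;
* `soloSpreadPi H j`  = number of classes met by column `j` (its spread),
  `soloSpreadH H c`   = number of columns meeting class `c`,
  `soloSpreadR Q p c` = number of directions whose fibre at `c` has at least `p` classes;
* `soloInformed_spreadCount` : under ALIGNMENT and (U), for every threshold `p` the incidences
  `(c, j) ∈ H` with `soloSpreadPi H j ≥ p` number at most `∑ c, min (soloSpreadH H c) (X c * soloSpreadR Q p c)`.

(In the note this is applied with `p = Π / 2b'`, after which the rich directions are counted by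
incidences with rich lines of a generic planar projection.)
-/

namespace Summit.ValiantsHypothesis.ValiantsHypothesis.Theorems

open Finset

/-- The spread of column `j`: the number of classes it meets. -/
def soloSpreadPi {N J : Type*} [DecidableEq J] (H : Finset (N × J)) (j : J) : ℕ :=
  (H.filter (fun q => q.2 = j)).card

/-- The number of columns meeting the class `c`. -/
def soloSpreadH {N J : Type*} [DecidableEq N] (H : Finset (N × J)) (c : N) : ℕ :=
  (H.filter (fun q => q.1 = c)).card

/-- The number of `p`-rich directions at the class `c`: directions `d` whose fibre `Q d c` has at
least `p` members. -/
def soloSpreadR {N D : Type*} [Fintype D] (Q : D → N → Finset N) (p : ℕ) (c : N) : ℕ :=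
  (Finset.univ.filter (fun d => p ≤ (Q d c).card)).card

/-- The spread count.  ALIGNMENT (`halign`): two incidences of the same column have their classes in
one fibre of the column's direction.  (U) (`hU`): at most `X c` columns of direction `d` meet the class
`c`.  Then the incidences whose column has spread `≥ p` number at most
`∑ c, min (soloSpreadH H c) (X c * soloSpreadR Q p c)`. -/
theorem soloInformed_spreadCount {N J D : Type*} [Fintype N] [DecidableEq N] [DecidableEq J]
    [Fintype D] [DecidableEq D]
    (H : Finset (N × J)) (τ : J → D) (Q : D → N → Finset N) (X : N → ℕ)
    (halign : ∀ q ∈ H, ∀ q' ∈ H, q.2 = q'.2 → q'.1 ∈ Q (τ q.2) q.1)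
    (hU : ∀ c d, (H.filter (fun q => q.1 = c ∧ τ q.2 = d)).card ≤ X c) (p : ℕ) :
    (H.filter (fun q => p ≤ soloSpreadPi H q.2)).card
      ≤ ∑ c, min (soloSpreadH H c) (X c * soloSpreadR Q p c) := by
  classical
  -- (1) the spread of a column is at most the size of the fibre it lies in
  have hpi : ∀ q ∈ H, soloSpreadPi H q.2 ≤ (Q (τ q.2) q.1).card := by
    intro q hq
    unfold soloSpreadPi
    refine Finset.card_le_card_of_injOn Prod.fst ?_ ?_
    · intro q' hq'
      have hq'' : q' ∈ H ∧ q'.2 = q.2 := by simpa using hq'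
      have hgoal : q'.1 ∈ Q (τ q.2) q.1 := halign q hq q' hq''.1 hq''.2.symm
      simpa using hgoal
    · intro a ha b hb hab
      have ha' := (Finset.mem_filter.mp (Finset.mem_coe.mp ha)).2
      have hb' := (Finset.mem_filter.mp (Finset.mem_coe.mp hb)).2
      exact Prod.ext hab (ha'.trans hb'.symm)
  -- (2) the rich incidences sit inside the incidences with a rich fibre
  set S := H.filter (fun q => p ≤ soloSpreadPi H q.2) with hS
  set S' := H.filter (fun q => p ≤ (Q (τ q.2) q.1).card) with hS'
  have hSsub : S ⊆ S' := by
    intro q hq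
    rw [hS, Finset.mem_filter] at hq
    rw [hS', Finset.mem_filter]
    exact ⟨hq.1, hq.2.trans (hpi q hq.1)⟩
  -- (3) count fibrewise over the classes
  have hfib : S'.card = ∑ c, (S'.filter (fun q => q.1 = c)).card :=
    Finset.card_eq_sum_card_fiberwise (fun q _ => Finset.mem_univ q.1)
  have hbound : ∀ c, (S'.filter (fun q => q.1 = c)).card
      ≤ min (soloSpreadH H c) (X c * soloSpreadR Q p c) := by
    intro c
    apply le_min
    · -- at most the number of columns meeting `c`
      unfold soloSpreadH
      apply Finset.card_le_card
      intro q hq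
      rw [Finset.mem_filter] at hq ⊢
      rw [hS', Finset.mem_filter] at hq
      exact ⟨hq.1.1, hq.2⟩
    · -- at most `X c` per rich direction, by (U)
      set T := S'.filter (fun q => q.1 = c) with hT
      set R := Finset.univ.filter (fun d => p ≤ (Q d c).card) with hR
      have hmap : ∀ q ∈ T, τ q.2 ∈ R := by
        intro q hq
        rw [hT, Finset.mem_filter, hS', Finset.mem_filter] at hq
        rw [hR, Finset.mem_filter]
        refine ⟨Finset.mem_univ _, ?_⟩
        have h1 := hq.1.2
        rw [hq.2] at h1
        exact h1
      have hTfib : T.card = ∑ d ∈ R, (T.filter (fun q => τ q.2 = d)).card :=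
        Finset.card_eq_sum_card_fiberwise hmap
      have hle : ∀ d ∈ R, (T.filter (fun q => τ q.2 = d)).card ≤ X c := by
        intro d _
        refine le_trans (Finset.card_le_card ?_) (hU c d)
        intro q hq
        rw [Finset.mem_filter] at hq ⊢
        rw [hT, Finset.mem_filter, hS', Finset.mem_filter] at hq
        exact ⟨hq.1.1.1, hq.1.2, hq.2⟩
      have hRcard : R.card = soloSpreadR Q p c := by
        rw [hR]; rfl
      calc T.card = ∑ d ∈ R, (T.filter (fun q => τ q.2 = d)).card := hTfib
        _ ≤ ∑ d ∈ R, X c := Finset.sum_le_sum hle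
        _ = R.card * X c := by rw [Finset.sum_const, smul_eq_mul]
        _ = X c * soloSpreadR Q p c := by rw [hRcard, Nat.mul_comm]
  calc S.card ≤ S'.card := Finset.card_le_card hSsub
    _ = ∑ c, (S'.filter (fun q => q.1 = c)).card := hfib
    _ ≤ ∑ c, min (soloSpreadH H c) (X c * soloSpreadR Q p c) :=
        Finset.sum_le_sum (fun c _ => hbound c)

/-- Markov form used in the note: the columns of spread `< p` carry fewer than `p` incidences each, so
if there are at most `b` columns with an incidence then the incidences with a `p`-poor column number
at most `b * p`... stated here in the exact form `#H ≤ #(rich part) + p * #(columns present)`. -/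
theorem soloInformed_spreadMarkov {N J : Type*} [DecidableEq N] [DecidableEq J]
    (H : Finset (N × J)) (p : ℕ) :
    H.card ≤ (H.filter (fun q => p ≤ soloSpreadPi H q.2)).card + p * (H.image Prod.snd).card := by
  classical
  -- split H into rich and poor incidences
  have hsplit : H.card = (H.filter (fun q => p ≤ soloSpreadPi H q.2)).card
      + (H.filter (fun q => ¬ p ≤ soloSpreadPi H q.2)).card := by
    rw [Finset.card_filter_add_card_filter_not]
  rw [hsplit]
  apply Nat.add_le_add_left
  -- the poor part, fibrewise over the columns present
  set P := H.filter (fun q => ¬ p ≤ soloSpreadPi H q.2) with hP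
  have hmap : ∀ q ∈ P, q.2 ∈ H.image Prod.snd := by
    intro q hq
    rw [hP, Finset.mem_filter] at hq
    exact Finset.mem_image_of_mem Prod.snd hq.1
  have hfib : P.card = ∑ j ∈ H.image Prod.snd, (P.filter (fun q => q.2 = j)).card :=
    Finset.card_eq_sum_card_fiberwise hmap
  have hle : ∀ j ∈ H.image Prod.snd, (P.filter (fun q => q.2 = j)).card ≤ p := by
    intro j _
    by_cases hj : p ≤ soloSpreadPi H j
    · -- then no poor incidence has column j
      have : P.filter (fun q => q.2 = j) = ∅ := by
        rw [Finset.filter_eq_empty_iff]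
        intro q hq hqj
        rw [hP, Finset.mem_filter] at hq
        apply hq.2
        rw [hqj]
        exact hj
      rw [this, Finset.card_empty]
      exact Nat.zero_le _
    · -- all of column j's incidences: fewer than p
      push Not at hj
      refine le_trans (Finset.card_le_card ?_) hj.le
      intro q hq
      rw [Finset.mem_filter] at hq
      rw [hP, Finset.mem_filter] at hq
      rw [Finset.mem_filter]
      exact ⟨hq.1.1, hq.2⟩
  calc P.card = ∑ j ∈ H.image Prod.snd, (P.filter (fun q => q.2 = j)).card := hfib
    _ ≤ ∑ j ∈ H.image Prod.snd, p := Finset.sum_le_sum hle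
    _ = p * (H.image Prod.snd).card := by rw [Finset.sum_const, smul_eq_mul, Nat.mul_comm]

end Summit.ValiantsHypothesis.ValiantsHypothesis.Theorems
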